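import Summits.CriticalPhenomena.SAWScalingLimit.Theses.SAWDefectDecoherence
import Summits.CriticalPhenomena.SAWScalingLimit.Theorems.ObservableToSLE.Negative.HypothesisSilence

/-!
# Crux `ObservableToSLER` (stmt-CriticalPhenomena-14005): `HexObservableLimitR` is silent outside the co-oriented flat class

Negative lemmas (refuter, cdisprove cycle 2) for the glue crux
`ObservableToSLER : HexObservableLimitR → HexTight → ⟨DCS 2012 Conjecture 1⟩`.

`ObsLimitRBody c D` is the per-domain content of the hypothesis `HexObservableLimitR` (item 14003):
`HexObservableLimitR ↔ ∃ c ≠ 0, ∀ D, ObsLimitRBody c D` (`obsLimitR_iff_body`, definitional).  Its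
two ball clauses pin BOTH marked points on HORIZONTAL flat pieces with the domain ABOVE
(inner normal `+I`).  We prove:

* `rFlat_false_of_flatAt` — if `D` is flat at `pt i` in ANY other unit orientation `u ≠ 1`
  (`FlatAt D i u ρ₀`: `D ∩ B(pt i, ρ₀) = {im(ū(z − pt i)) > 0} ∩ B(pt i, ρ₀)`), then the class-`1`
  clause of `HexObservableLimitR` at `pt i` is false at EVERY radius `ρ > 0`
  (witness `pt i + t·I(1 − u)`, `t = min ρ ρ₀ / 4`);
* hence `ObsLimitRBody c D` holds OUTRIGHT for every constant `c` on every such domain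
  (`obsLimitRBody_of_flatAt`, `obsLimitRBody_of_flatAt_rootOfUnity` for the six lattice
  orientations `u ^ 6 = 1`), exactly as on the unit disc (`obsLimitRBody_unitDisc`);
* with the two-piece flat pinning of the renewal/gate crux ideas made explicit
  (`IsFlatPinnedWith D u ρ`, `u : Fin 2 → ℂ`, `(u i)^6 = 1`; card 3's `IsFlatPinned D ρ` is
  `∃ u, IsFlatPinnedWith D u ρ`, `isFlatPinned_iff`): of the 36 orientation pairs the hypothesis
  binds exactly `(1, 1)` (`isFlatPinnedWith_one_iff`); it is free as soon as one orientation is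
  `≠ 1` (`obsLimitRBody_of_isFlatPinnedWith`), in particular on every pair of NONZERO RELATIVE
  CLASS `u 0 ≠ u 1` (`obsLimitRBody_of_relativeClass_ne`), which no global lattice symmetry maps to
  the co-oriented class; and `HexObservableLimitR` is equivalent to itself restricted to domains
  without any tilted/flipped flat piece (`obsLimitR_iff_untilted`);
* the PER-DOMAIN reading of the crux (content of the hypothesis at `D` + `HexTight` ⇒ Conjecture 1
  at `D`, written inline as a hypothesis) implies the crux (`observableToSLER_of_perDomain`) but
  contains `HexTight → Conjecture 1` on the disc and on every tilted two-piece domain with NO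
  observable input (`perDomain_disc`, `perDomain_tilted`, `perDomain_observableFree`).

Reading for provers / the lead of the merged gate line (bridge-gate-renewal ≈
bridge-point-germ-transfer): the two-piece floor identification K2 must cover the relative classes
`60°, …, 300°` (on `(𝔻; −i, i)`-type targets every gate pair has nonzero relative class), and the
crux's hypothesis says nothing there — the orientation transfer S1 (or a planner re-typing of item
14003's ball clauses with independent orientations `u_i ^ 6 = 1`, still immune to the corridor
witness of item 5420 since the root ball stays rigid) is load-bearing; and no line may consume the
hypothesis only at the target domain: the crux is irreducibly a transfer statement.
-/

noncomputable section

open Literature.Probability.RandomPlanarGeometry Literature.Probability.RandomPlanarGeometry.SAW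
  Literature.Probability.LatticeModels MeasureTheory Filter Topology Set
open scoped NNReal

namespace Summit.CriticalPhenomena.SAWScalingLimit.Theorems.ObservableToSLER.Negative

open Summit.CriticalPhenomena.SAWScalingLimit.Theses
open Summit.CriticalPhenomena.SAWScalingLimit.Theorems.ObservableToSLE.Negative

/-! ## The per-domain content of `HexObservableLimitR` -/

/-- The per-domain, per-constant CONTENT of `HexObservableLimitR` (its `∀`-body at a fixed
Dobrushin domain `D` and constant `c`); an auxiliary predicate, not a fact
(`obsLimitR_iff_body`). [folklore] -/
def ObsLimitRBody (c : ℂ) (D : DobrushinDomain) : Prop :=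
  ∀ (ρ : ℝ) (Λ : ℝ → Finset HexVertex) (m : Fin 2 → ℝ → ℤ) (a b : ℝ → Sym2 HexVertex)
    (Φ : ConformalEquiv D.carrier UpperHalfPlane.upperHalfPlaneSet) (L : ℂ → ℂ) (Lb : ℂ) (ψ : ℂ → ℂ),
    let F : ℝ → Sym2 HexVertex → ℂ := fun δ z =>
      hexParafermionicObservable (Λ δ) (a δ) hexCriticalFugacity (5 / 8) z
    0 < ρ →
    (∀ i : Fin 2, D.carrier ∩ Metric.ball (D.pt i) ρ =
      {z : ℂ | (D.pt i).im < z.im} ∩ Metric.ball (D.pt i) ρ) →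
    (∀ᶠ δ : ℝ in nhdsWithin 0 (Set.Ioi 0),
      hexDomainSimplyConnected (Λ δ) ∧ a δ ∈ hexDomainBoundary (Λ δ) ∧
        b δ ∈ hexDomainBoundary (Λ δ) ∧ Nonempty (HexMidEdgeSAW (Λ δ) (a δ) (b δ)) ∧
        (hexGraph.induce ((Λ δ : Finset HexVertex) : Set HexVertex)).Preconnected ∧
        (∀ v ∈ Λ δ, (δ : ℂ) * hexCenter v ∈ D.carrier) ∧
        (∀ i : Fin 2, ∀ v : HexVertex, (δ : ℂ) * hexCenter v ∈ Metric.ball (D.pt i) ρ →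
          (v ∈ Λ δ ↔ m i δ ≤ v.1 1))) →
    (∀ K : Set ℂ, IsCompact K → K ⊆ D.carrier → ∀ᶠ δ : ℝ in nhdsWithin 0 (Set.Ioi 0),
      ∀ v : HexVertex, (δ : ℂ) * hexCenter v ∈ K → v ∈ Λ δ) →
    Tendsto (fun δ : ℝ => (δ : ℂ) * hexMidpoint (a δ)) (nhdsWithin 0 (Set.Ioi 0)) (nhds (D.pt 0)) →
    Tendsto (fun δ : ℝ => (δ : ℂ) * hexMidpoint (b δ)) (nhdsWithin 0 (Set.Ioi 0)) (nhds (D.pt 1)) →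
    Tendsto (fun x => ‖Φ x‖) (nhdsWithin (D.pt 0) D.carrier) atTop →
    Φ.HasBoundaryValue (D.pt 1) 0 →
    ContinuousOn L D.carrier → (∀ z ∈ D.carrier, Complex.exp (L z) = deriv Φ z) →
    Tendsto L (nhdsWithin (D.pt 1) D.carrier) (nhds Lb) →
    Continuous ψ → HasCompactSupport ψ → tsupport ψ ⊆ D.carrier →
    Tendsto (fun δ : ℝ => (δ : ℂ) ^ 2 * (∑ᶠ e ∈ hexDomainMidEdges (Λ δ),
      ψ ((δ : ℂ) * hexMidpoint e) * F δ e) / F δ (b δ)) (nhdsWithin 0 (Set.Ioi 0))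
      (nhds (c * ∫ z, ψ z * Complex.exp ((5 / 8 : ℂ) * (L z - Lb))))

/-- `HexObservableLimitR ↔ ∃ c ≠ 0, ∀ D, ObsLimitRBody c D` (definitional). [folklore] -/
theorem obsLimitR_iff_body :
    SAWDefectDecoherence.HexObservableLimitR ↔ ∃ c : ℂ, c ≠ 0 ∧ ∀ D, ObsLimitRBody c D :=
  Iff.rfl

/-- SILENCE ON THE DISC in positive form: the content of `HexObservableLimitR` on the unit disc is
provable outright, for every constant (its flat premise fails there,
`flat_premise_false_on_unitDisc`). [folklore] -/
theorem obsLimitRBody_unitDisc (c : ℂ) : ObsLimitRBody c DobrushinDomain.unitDisc := by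
  intro ρ Λ m a b Φ L Lb ψ _ hρ hflat
  exact absurd (hflat 1) (flat_premise_false_on_unitDisc ρ hρ)

/-! ## Flat pieces of arbitrary orientation -/

/-- `D` is FLAT at the marked point `pt i` at radius `ρ` with inner unit normal `u·I`: inside
`B(pt i, ρ)` the domain is the open half-plane `{im(ū (z − pt i)) > 0}`.  For `u = 1` this is
verbatim the ball clause of `HexObservableLimitR` (`flatAt_one_iff`); `u ^ 6 = 1` gives the six
lattice half-plane orientations.  An auxiliary predicate, not a fact. [folklore] -/
def FlatAt (D : DobrushinDomain) (i : Fin 2) (u : ℂ) (ρ : ℝ) : Prop :=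
  D.carrier ∩ Metric.ball (D.pt i) ρ =
    {z : ℂ | 0 < ((starRingEnd ℂ) u * (z - D.pt i)).im} ∩ Metric.ball (D.pt i) ρ

/-- Orientation `u = 1` is exactly the ball clause of `HexObservableLimitR`. [folklore] -/
theorem flatAt_one_iff (D : DobrushinDomain) (i : Fin 2) (ρ : ℝ) :
    FlatAt D i 1 ρ ↔
      D.carrier ∩ Metric.ball (D.pt i) ρ = {z : ℂ | (D.pt i).im < z.im} ∩ Metric.ball (D.pt i) ρ := by
  unfold FlatAt
  have : {z : ℂ | 0 < ((starRingEnd ℂ) (1 : ℂ) * (z - D.pt i)).im} = {z : ℂ | (D.pt i).im < z.im} := by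
    ext z
    simp only [map_one, one_mul, Complex.sub_im, Set.mem_setOf_eq, sub_pos]
  rw [this]

/-- The witness direction: for a unit `u ≠ 1`, `w = I (1 − u)` points INTO the class-`1` half-plane
(`im w = 1 − re u > 0`) and OUT of the class-`u` half-plane (`im(ū w) = re u − 1 < 0`), and
`‖w‖ ≤ 2`. [folklore] -/
theorem witness_dir {u : ℂ} (hu : ‖u‖ = 1) (hu1 : u ≠ 1) :
    0 < (Complex.I * (1 - u)).im ∧ ((starRingEnd ℂ) u * (Complex.I * (1 - u))).im < 0 ∧
      ‖Complex.I * (1 - u)‖ ≤ 2 := by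
  have hsq : u.re * u.re + u.im * u.im = 1 := by
    have h := Complex.normSq_eq_norm_sq u
    rw [hu, Complex.normSq_apply] at h
    nlinarith
  have hre : u.re < 1 := by
    rcases (Complex.abs_re_le_norm u).lt_or_eq with h | h
    · rw [hu] at h
      exact (le_abs_self _).trans_lt h
    · rw [hu] at h
      have him : u.im = 0 := by
        have : u.re * u.re = 1 := by
          rcases abs_eq (zero_le_one) |>.1 h with h' | h' <;> rw [h'] <;> ring
        nlinarith
      rcases abs_eq (zero_le_one) |>.1 h with h' | h'
      · exact absurd (Complex.ext (by simpa using h') (by simpa using him)) hu1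
      · rw [h']; norm_num
  refine ⟨?_, ?_, ?_⟩
  · simp only [Complex.mul_im, Complex.I_re, Complex.sub_im, Complex.one_im, zero_sub, zero_mul,
      Complex.I_im, Complex.sub_re, Complex.one_re, one_mul, zero_add]
    linarith
  · simp only [Complex.mul_im, Complex.mul_re, Complex.I_re, Complex.sub_re, Complex.one_re, zero_mul,
      Complex.I_im, Complex.sub_im, Complex.one_im, zero_sub, one_mul, zero_add, Complex.conj_re,
      Complex.conj_im]
    nlinarith
  · calc ‖Complex.I * (1 - u)‖ = ‖(1 : ℂ) - u‖ := by rw [norm_mul, Complex.norm_I, one_mul]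
      _ ≤ ‖(1 : ℂ)‖ + ‖u‖ := norm_sub_le _ _
      _ = 2 := by rw [hu]; norm_num

/-- **A TILTED OR FLIPPED FLAT PIECE FALSIFIES THE HYPOTHESIS' BALL CLAUSE AT EVERY RADIUS.**  If
`D` is flat at `pt i` in orientation `u` (`‖u‖ = 1`, `u ≠ 1`) at some radius `ρ₀ > 0`, then for
every `ρ > 0` the class-`1` clause `D ∩ B(pt i, ρ) = {im z > im (pt i)} ∩ B(pt i, ρ)` of
`HexObservableLimitR` is false (witness `pt i + t·I(1 − u)`, `t = min ρ ρ₀ / 4`). [folklore] -/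
theorem rFlat_false_of_flatAt {D : DobrushinDomain} {i : Fin 2} {u : ℂ} {ρ₀ : ℝ}
    (hu : ‖u‖ = 1) (hu1 : u ≠ 1) (hρ₀ : 0 < ρ₀) (h : FlatAt D i u ρ₀) (ρ : ℝ) (hρ : 0 < ρ) :
    D.carrier ∩ Metric.ball (D.pt i) ρ ≠ {z : ℂ | (D.pt i).im < z.im} ∩ Metric.ball (D.pt i) ρ := by
  obtain ⟨hw1, hw2, hw3⟩ := witness_dir hu hu1
  set w : ℂ := Complex.I * (1 - u) with hw
  set t : ℝ := min ρ ρ₀ / 4 with ht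
  have hmin : 0 < min ρ ρ₀ := lt_min hρ hρ₀
  have ht0 : 0 < t := by positivity
  set z : ℂ := D.pt i + (t : ℂ) * w with hz
  have hdist : dist z (D.pt i) < min ρ ρ₀ := by
    rw [dist_eq_norm, hz, add_sub_cancel_left, norm_mul, Complex.norm_real, Real.norm_of_nonneg ht0.le]
    calc t * ‖w‖ ≤ t * 2 := by gcongr
      _ = min ρ ρ₀ / 2 := by rw [ht]; ring
      _ < min ρ ρ₀ := by linarith
  have hzρ : z ∈ Metric.ball (D.pt i) ρ := (hdist.trans_le (min_le_left _ _))
  have hzρ₀ : z ∈ Metric.ball (D.pt i) ρ₀ := (hdist.trans_le (min_le_right _ _))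
  have hzim : (D.pt i).im < z.im := by
    rw [hz, Complex.add_im, Complex.mul_im, Complex.ofReal_re, Complex.ofReal_im, zero_mul, add_zero]
    have : 0 < t * w.im := mul_pos ht0 hw1
    linarith
  intro hEq
  have hzD : z ∈ D.carrier := by
    have : z ∈ {z : ℂ | (D.pt i).im < z.im} ∩ Metric.ball (D.pt i) ρ := ⟨hzim, hzρ⟩
    rw [← hEq] at this
    exact this.1
  have hz' : z ∈ D.carrier ∩ Metric.ball (D.pt i) ρ₀ := ⟨hzD, hzρ₀⟩
  rw [h] at hz'
  have hpos := hz'.1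
  simp only [Set.mem_setOf_eq, hz, add_sub_cancel_left] at hpos
  have key : ((starRingEnd ℂ) u * ((t : ℂ) * w)).im = t * ((starRingEnd ℂ) u * w).im := by
    have e : (starRingEnd ℂ) u * ((t : ℂ) * w) = (t : ℂ) * ((starRingEnd ℂ) u * w) := by ring
    rw [e, Complex.im_ofReal_mul]
  rw [key] at hpos
  have : t * ((starRingEnd ℂ) u * w).im < 0 := mul_neg_of_pos_of_neg ht0 hw2
  linarith

/-- Sixth roots of unity are unit complex numbers. [folklore] -/
theorem norm_eq_one_of_pow_six {u : ℂ} (hu : u ^ 6 = 1) : ‖u‖ = 1 := by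
  have h : ‖u‖ ^ 6 = 1 := by rw [← norm_pow, hu, norm_one]
  exact (pow_eq_one_iff_of_nonneg (norm_nonneg u) (by norm_num)).1 h

/-- **THE HYPOTHESIS IS SILENT ON EVERY DOMAIN WITH A TILTED OR FLIPPED FLAT PIECE AT A MARKED
POINT** (positive form): `ObsLimitRBody c D` is provable outright, for every constant `c`, as soon
as ONE marked point carries a flat piece of unit orientation `u ≠ 1`. [folklore] -/
theorem obsLimitRBody_of_flatAt {D : DobrushinDomain} {i : Fin 2} {u : ℂ} {ρ₀ : ℝ}
    (hu : ‖u‖ = 1) (hu1 : u ≠ 1) (hρ₀ : 0 < ρ₀) (h : FlatAt D i u ρ₀) (c : ℂ) :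
    ObsLimitRBody c D := by
  intro ρ Λ m a b Φ L Lb ψ _ hρ hflat
  exact absurd (hflat i) (rFlat_false_of_flatAt hu hu1 hρ₀ h ρ hρ)

/-- The six-orientation version (the lattice half-plane classes `u ^ 6 = 1`). [folklore] -/
theorem obsLimitRBody_of_flatAt_rootOfUnity {D : DobrushinDomain} {i : Fin 2} {u : ℂ} {ρ₀ : ℝ}
    (hu : u ^ 6 = 1) (hu1 : u ≠ 1) (hρ₀ : 0 < ρ₀) (h : FlatAt D i u ρ₀) (c : ℂ) :
    ObsLimitRBody c D :=
  obsLimitRBody_of_flatAt (norm_eq_one_of_pow_six hu) hu1 hρ₀ h c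

/-! ## Two-piece flat pinning with explicit orientations -/

/-- Two-piece flat pinning with the orientations made explicit: radius `ρ > 0`, and at each marked
point a flat piece of lattice orientation `u i` (`(u i)^6 = 1`).  Card 3's `IsFlatPinned D ρ`
(crux idea bridge-point-germ-transfer) is `∃ u, IsFlatPinnedWith D u ρ` (`isFlatPinned_iff`).
An auxiliary predicate, not a fact. [folklore] -/
def IsFlatPinnedWith (D : DobrushinDomain) (u : Fin 2 → ℂ) (ρ : ℝ) : Prop :=
  0 < ρ ∧ ∀ i : Fin 2, u i ^ 6 = 1 ∧ FlatAt D i (u i) ρ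

/-- Verbatim copy of card 3's `IsFlatPinned` (flat-pinned at both marked points in any of the six
lattice orientations); an auxiliary predicate, not a fact. [folklore] -/
def IsFlatPinned (D : DobrushinDomain) (ρ : ℝ) : Prop :=
  0 < ρ ∧ ∀ i : Fin 2, ∃ u : ℂ, u ^ 6 = 1 ∧
    D.carrier ∩ Metric.ball (D.pt i) ρ =
      {z : ℂ | 0 < ((starRingEnd ℂ) u * (z - D.pt i)).im} ∩ Metric.ball (D.pt i) ρ

/-- Card 3's class is the union of the 36 explicit orientation pairs. [folklore] -/
theorem isFlatPinned_iff (D : DobrushinDomain) (ρ : ℝ) :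
    IsFlatPinned D ρ ↔ ∃ u : Fin 2 → ℂ, IsFlatPinnedWith D u ρ := by
  constructor
  · rintro ⟨hρ, h⟩
    choose u hu using h
    exact ⟨u, hρ, fun i => hu i⟩
  · rintro ⟨u, hρ, h⟩
    exact ⟨hρ, fun i => ⟨u i, h i⟩⟩

/-- **OF THE 36 ORIENTATION PAIRS, THE HYPOTHESIS SPEAKS ABOUT ONE.**  If either orientation differs
from `1`, the content of `HexObservableLimitR` at `D` is free. [folklore] -/
theorem obsLimitRBody_of_isFlatPinnedWith {D : DobrushinDomain} {u : Fin 2 → ℂ} {ρ : ℝ}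
    (h : IsFlatPinnedWith D u ρ) (hu : ∃ i, u i ≠ 1) (c : ℂ) : ObsLimitRBody c D := by
  obtain ⟨i, hi⟩ := hu
  exact obsLimitRBody_of_flatAt_rootOfUnity (h.2 i).1 hi h.1 (h.2 i).2 c

/-- … in particular on every domain of NONZERO RELATIVE CLASS (`u 0 ≠ u 1`), which no global
lattice symmetry maps to the co-oriented class. [folklore] -/
theorem obsLimitRBody_of_relativeClass_ne {D : DobrushinDomain} {u : Fin 2 → ℂ} {ρ : ℝ}
    (h : IsFlatPinnedWith D u ρ) (hu : u 0 ≠ u 1) (c : ℂ) : ObsLimitRBody c D := by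
  by_cases h0 : u 0 = 1
  · exact obsLimitRBody_of_isFlatPinnedWith h ⟨1, fun h1 => hu (h0.trans h1.symm)⟩ c
  · exact obsLimitRBody_of_isFlatPinnedWith h ⟨0, h0⟩ c

/-- Conversely the co-oriented pair `(1, 1)` is exactly the two-ball premise of
`HexObservableLimitR`. [folklore] -/
theorem isFlatPinnedWith_one_iff (D : DobrushinDomain) (ρ : ℝ) :
    IsFlatPinnedWith D (fun _ => 1) ρ ↔
      0 < ρ ∧ ∀ i : Fin 2, D.carrier ∩ Metric.ball (D.pt i) ρ =
        {z : ℂ | (D.pt i).im < z.im} ∩ Metric.ball (D.pt i) ρ := by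
  unfold IsFlatPinnedWith
  simp only [one_pow, true_and]
  exact and_congr Iff.rfl (forall_congr' fun i => flatAt_one_iff D i ρ)

/-- `HexObservableLimitR` is equivalent to itself RESTRICTED to domains without any tilted/flipped
flat piece at a marked point: the hypothesis of the crux never constrains the observable on the
classes the two-piece floor identification must cover beyond `(1, 1)`. [folklore] -/
theorem obsLimitR_iff_untilted :
    SAWDefectDecoherence.HexObservableLimitR ↔
      ∃ c : ℂ, c ≠ 0 ∧ ∀ D : DobrushinDomain,
        (∀ (i : Fin 2) (u : ℂ) (ρ₀ : ℝ), 0 < ρ₀ → ‖u‖ = 1 → u ≠ 1 → ¬ FlatAt D i u ρ₀) →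
          ObsLimitRBody c D := by
  rw [obsLimitR_iff_body]
  constructor
  · rintro ⟨c, hc, h⟩
    exact ⟨c, hc, fun D _ => h D⟩
  · rintro ⟨c, hc, h⟩
    refine ⟨c, hc, fun D => ?_⟩
    by_cases hD : ∃ (i : Fin 2) (u : ℂ) (ρ₀ : ℝ), 0 < ρ₀ ∧ ‖u‖ = 1 ∧ u ≠ 1 ∧ FlatAt D i u ρ₀
    · obtain ⟨i, u, ρ₀, hρ₀, hu, hu1, hF⟩ := hD
      exact obsLimitRBody_of_flatAt hu hu1 hρ₀ hF c
    · push Not at hD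
      exact h D fun i u ρ₀ hρ₀ hu hu1 hF => hD i u ρ₀ hρ₀ hu hu1 hF

/-! ## The per-domain reading of the crux is observable-free where the hypothesis is silent -/

/-- The conclusion of the crux AT ONE Dobrushin domain (DCS Conjecture 1 at `D`); an auxiliary
predicate (`hexSAWScalingLimit_iff_forall_conclusionAt`), not a fact. [folklore] -/
def ConclusionAt (D : DobrushinDomain) : Prop :=
  ∀ a b : ℝ → HexVertex, IsEmbEndpointApprox hexGraph hexCenter D a b →
    ConvergesInLawToSLE ((8 : ℝ≥0) / 3) D
      (fun δ (γ : HexDomainSAW D.carrier δ (a δ) (b δ)) => γ.curve)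
      (fun δ => hexSAWLaw D.carrier δ (a δ) (b δ))

/-- `HexSAWScalingLimit ↔ ∀ D, ConclusionAt D` (definitional): DCS 2012 Conjecture 1, the registered
open statement `Literature.Probability.RandomPlanarGeometry.SAW.HexSAWScalingLimit`, is `ConclusionAt`
at every Dobrushin domain.  Maintenance record (full-build repair, 2026-08-16): this bookkeeping lemma
was stated against the route decl `SAWDefectDecoherence.HexConjecture` (the shared item
stmt-CriticalPhenomena-0808, whose body is token-identical to `HexSAWScalingLimit`), dropped from the
gate-written route file at route rev 17 (2026-08-16T03:09:13Z, route choice "option a"), after which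
the name no longer resolved; it is re-pointed to the literature registry decl (same proposition, same
`Iff.rfl` proof) under a new name, the old name surviving as a deprecated alias. [folklore] -/
theorem hexSAWScalingLimit_iff_forall_conclusionAt :
    HexSAWScalingLimit ↔ ∀ D, ConclusionAt D := Iff.rfl

/-- Deprecated name of `hexSAWScalingLimit_iff_forall_conclusionAt` (it was stated against the route
decl `SAWDefectDecoherence.HexConjecture`, dropped from the route file at rev 17). [folklore] -/
@[deprecated hexSAWScalingLimit_iff_forall_conclusionAt (since := "2026-08-16")]
alias hexConjecture_iff_forall_conclusionAt := hexSAWScalingLimit_iff_forall_conclusionAt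

/-- The PER-DOMAIN reading of the crux — "the content of the hypothesis at `D` (for some nonzero
constant) and tightness give DCS Conjecture 1 at the same `D`", written inline as
`∀ D, (∃ c ≠ 0, ObsLimitRBody c D) → HexTight → ConclusionAt D` — implies the crux. [folklore] -/
theorem observableToSLER_of_perDomain
    (h : ∀ D : DobrushinDomain, (∃ c : ℂ, c ≠ 0 ∧ ObsLimitRBody c D) →
      SAWDefectDecoherence.HexTight → ConclusionAt D) :
    SAWDefectDecoherence.ObservableToSLER := by
  intro hO hT D
  obtain ⟨c, hc, hb⟩ := obsLimitR_iff_body.1 hO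
  exact h D ⟨c, hc, hb D⟩ hT

/-- … but the per-domain reading contains `HexTight → DCS Conjecture 1 on the unit disc` with NO
observable input. [folklore] -/
theorem perDomain_disc
    (h : ∀ D : DobrushinDomain, (∃ c : ℂ, c ≠ 0 ∧ ObsLimitRBody c D) →
      SAWDefectDecoherence.HexTight → ConclusionAt D)
    (hT : SAWDefectDecoherence.HexTight) : ConclusionAt DobrushinDomain.unitDisc :=
  h _ ⟨1, one_ne_zero, obsLimitRBody_unitDisc 1⟩ hT

/-- … and likewise on every two-piece flat domain with a tilted/flipped piece: the crux is
irreducibly a TRANSFER statement (no line may consume the hypothesis only at the target domain).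
[folklore] -/
theorem perDomain_tilted
    (h : ∀ D : DobrushinDomain, (∃ c : ℂ, c ≠ 0 ∧ ObsLimitRBody c D) →
      SAWDefectDecoherence.HexTight → ConclusionAt D)
    (hT : SAWDefectDecoherence.HexTight)
    {D : DobrushinDomain} {u : Fin 2 → ℂ} {ρ : ℝ} (hD : IsFlatPinnedWith D u ρ) (hu : ∃ i, u i ≠ 1) :
    ConclusionAt D :=
  h _ ⟨1, one_ne_zero, obsLimitRBody_of_isFlatPinnedWith hD hu 1⟩ hT

/-- The observable-free part isolated: under the per-domain reading, tightness ALONE gives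
Conjecture 1 on every domain where the hypothesis' premise fails at all radii with a tilted piece or
on the disc — i.e. the per-domain reading is the crux PLUS an observable-free conjecture. [folklore] -/
theorem perDomain_observableFree
    (h : ∀ D : DobrushinDomain, (∃ c : ℂ, c ≠ 0 ∧ ObsLimitRBody c D) →
      SAWDefectDecoherence.HexTight → ConclusionAt D)
    (hT : SAWDefectDecoherence.HexTight) (D : DobrushinDomain) (hfree : ∀ c : ℂ, ObsLimitRBody c D) :
    ConclusionAt D :=
  h D ⟨1, one_ne_zero, hfree 1⟩ hT

end Summit.CriticalPhenomena.SAWScalingLimit.Theorems.ObservableToSLER.Negative
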